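import Literature.LinearAlgebra.Matrix.UnitarySimultaneousSimilarity
import HarnessLib

/-!
# [Sengupta1994] Thm 2 VERBATIM for `U(n)` / `SU(n)`: if all POSITIVE products `g_{a₁}⋯g_{a_k}` and `g'_{a₁}⋯g'_{a_k}`
# are conjugate, the tuples are simultaneously conjugate — positive words suffice

statement-level skeleton of published theorems with citation tags; proofs where landed; nothing here is a claim about
the Yang–Mills mass gap

`UnitarySimultaneousSimilarity.exists_unitary_conj_of_trace_freeGroup_lift_eq` needs equal traces of all words in the
letters `V_i^{±1}`.  Sengupta's Theorem 2 ([Sengupta1994] p.900) assumes only that the POSITIVE products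
`g_{a₁}⋯g_{a_k}` and `g'_{a₁}⋯g'_{a_k}` are conjugate, and his proof begins (p.901): «By considering the diagonalized
form of the matrix g we see that there is a polynomial P(X) such that P(g) = g⁻¹. If g' ∈ G is conjugate to g then
P(g') = g'⁻¹. Therefore, we have (2) Tr(g^{ε₁}_{i₁}⋯g^{ε_k}_{i_k}) = Tr(g'^{ε₁}_{i₁}⋯g'^{ε_k}_{i_k}) for every k ≥ 1 …
and εᵢ ∈ {1, −1}.»  This file FOLLOWS that step: the inverse of an invertible matrix is the value of a polynomial
determined by its characteristic polynomial (Cayley–Hamilton; `exists_aeval_eq_inv_of_charpoly_eq`), so for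
unitary-valued `π, σ : Γ →* M_n(ℂ)` on ANY monoid `Γ` whose values have pairwise equal characteristic polynomials the
adjoints `π(γ)ᴴ = π(γ)⁻¹`, `σ(γ)ᴴ = σ(γ)⁻¹` are the images of ONE element of the monoid algebra `ℂ[Γ]` — which is all
the `*`-algebra argument needs (`exists_unitary_conj_of_trace_eq_of_adjoint_mem`, a generalisation of
`UnitarySimultaneousSimilarity.exists_unitary_conj_of_trace_eq` in which the adjoint of `π(γ)` may be any common
"polynomial" `π(y_γ)`, `σ(y_γ)` rather than a monoid element `π(sγ)`).  Results:
`exists_unitary_conj_of_charpoly_freeMonoid_lift_eq` (unitary tuples whose positive words have equal characteristic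
polynomials are simultaneously unitarily conjugate), and the verbatim group statements
`unitaryGroup_exists_conj_of_prod_conj` (`G = U(n)`) and `specialUnitaryGroup_exists_conj_of_prod_conj` (`G = SU(n)`,
by Sengupta's rescaling p.901 «scaling the y … by a suitable factor to ensure that it lies in SU(n)»,
`exists_mem_specialUnitaryGroup_conj_eq`).  DEVIATION as in the companion files: the `U(n)` core is proved by the
`*`-algebra route, not by Weyl's theorem on tensor invariants.
-/

open scoped ComplexOrder Matrix Polynomial
open Polynomial (aeval aeval_X aeval_C X C)

namespace Literature.LinearAlgebra.Matrix

variable {n : Type*} [Fintype n] [DecidableEq n]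

section InversePolynomial

/-- «there is a polynomial P(X) such that P(g) = g⁻¹. If g' is conjugate to g then P(g') = g'⁻¹» ([Sengupta1994]
p.901): for matrices `M, M'` with the SAME characteristic polynomial and `det M ≠ 0` there is one polynomial `q`
with `q(M) = M⁻¹` and `q(M') = M'⁻¹` (Cayley–Hamilton: `q = −c₀⁻¹ · (χ − c₀)/X`). [cite: Sengupta1994, proof of Thm 2 p.901] -/
theorem exists_aeval_eq_inv_of_charpoly_eq {M M' : Matrix n n ℂ} (hM : IsUnit M.det)
    (h : M.charpoly = M'.charpoly) : ∃ q : ℂ[X], aeval M q = M⁻¹ ∧ aeval M' q = M'⁻¹ := by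
  set p := M.charpoly with hp
  have hc0 : p.coeff 0 ≠ 0 := by
    intro h0
    apply hM.ne_zero
    rw [Matrix.det_eq_sign_charpoly_coeff, ← hp, h0, mul_zero]
  have key : ∀ A : Matrix n n ℂ, A.charpoly = p → aeval A (-C (p.coeff 0)⁻¹ * p.divX) = A⁻¹ := by
    intro A hA
    have hCH : aeval A p = 0 := by rw [← hA]; exact Matrix.aeval_self_charpoly A
    have h1 : A * aeval A p.divX = -(p.coeff 0) • (1 : Matrix n n ℂ) := by
      have h2 := congrArg (aeval A) (Polynomial.X_mul_divX_add p)
      rw [map_add, map_mul, aeval_X, aeval_C, hCH, Algebra.algebraMap_eq_smul_one] at h2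
      rw [neg_smul, eq_neg_iff_add_eq_zero, h2]
    symm
    apply Matrix.inv_eq_right_inv
    rw [map_mul, map_neg, aeval_C, Algebra.algebraMap_eq_smul_one, neg_mul, Matrix.smul_mul, Matrix.one_mul,
      Matrix.mul_neg, Matrix.mul_smul, h1, smul_smul, mul_neg, inv_mul_cancel₀ hc0, neg_smul, one_smul, neg_neg]
  exact ⟨_, key M rfl, key M' h.symm⟩

end InversePolynomial

section Adjoint

variable {Γ : Type*} [Monoid Γ]

/-- Equal characters on `Γ` ⟹ equal traces on `ℂ[Γ]`. [folklore] -/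
private theorem trace_lift_eq (π σ : Γ →* Matrix n n ℂ) (htr : ∀ γ, (π γ).trace = (σ γ).trace)
    (x : MonoidAlgebra ℂ Γ) :
    (MonoidAlgebra.lift ℂ (Matrix n n ℂ) Γ π x).trace = (MonoidAlgebra.lift ℂ (Matrix n n ℂ) Γ σ x).trace := by
  rw [MonoidAlgebra.lift_apply, MonoidAlgebra.lift_apply]
  simp only [Finsupp.sum, Matrix.trace_sum, Matrix.trace_smul, htr]

/-- If `(ρ γ)ᴴ = ρ (y γ)` for elements `y γ ∈ ℂ[Γ]`, then `(ρ x)ᴴ = ρ (Σ conj(x_γ) y γ)`. [folklore] -/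
private theorem lift_adj' (ρ : Γ →* Matrix n n ℂ) (y : Γ → MonoidAlgebra ℂ Γ)
    (hρ : ∀ γ, MonoidAlgebra.lift ℂ (Matrix n n ℂ) Γ ρ (y γ) = (ρ γ)ᴴ) (x : MonoidAlgebra ℂ Γ) :
    MonoidAlgebra.lift ℂ (Matrix n n ℂ) Γ ρ (x.coeff.sum fun γ c => star c • y γ)
      = (MonoidAlgebra.lift ℂ (Matrix n n ℂ) Γ ρ x)ᴴ := by
  conv_rhs => rw [MonoidAlgebra.lift_apply _ x]
  simp only [Finsupp.sum, map_sum, map_smul, hρ, Matrix.conjTranspose_sum, Matrix.conjTranspose_smul]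

/-- **Equal characters + JOINTLY POLYNOMIAL ADJOINTS ⟹ unitary equivalence.**  `π, σ : Γ →* M_n(ℂ)` on a monoid
`Γ`; suppose `tr π(γ) = tr σ(γ)` for all `γ`, and that for every `γ` some element `y ∈ ℂ[Γ]` has `π(y) = π(γ)ᴴ` AND
`σ(y) = σ(γ)ᴴ`.  Then `σ(γ) = u π(γ) uᴴ` for one unitary `u`.  (Generalises
`UnitarySimultaneousSimilarity.exists_unitary_conj_of_trace_eq`, where `y = sγ ∈ Γ`; [GoodmanWallachGTM255] Thm 4.1.19 +
unitarisation.) [cite: GoodmanWallachGTM255, §4.1.7 Thm 4.1.19] -/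
theorem exists_unitary_conj_of_trace_eq_of_adjoint_mem (π σ : Γ →* Matrix n n ℂ)
    (hadj : ∀ γ, ∃ y : MonoidAlgebra ℂ Γ, MonoidAlgebra.lift ℂ (Matrix n n ℂ) Γ π y = (π γ)ᴴ ∧
      MonoidAlgebra.lift ℂ (Matrix n n ℂ) Γ σ y = (σ γ)ᴴ)
    (htr : ∀ γ, (π γ).trace = (σ γ).trace) :
    ∃ u : Matrix n n ℂ, u ∈ Matrix.unitaryGroup n ℂ ∧ ∀ γ, σ γ = u * π γ * uᴴ := by
  choose y hyπ hyσ using hadj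
  set Λπ := MonoidAlgebra.lift ℂ (Matrix n n ℂ) Γ π with hΛπ
  set Λσ := MonoidAlgebra.lift ℂ (Matrix n n ℂ) Γ σ with hΛσ
  -- the formal adjoint `x† = Σ conj(x_γ) y_γ`
  let adj : MonoidAlgebra ℂ Γ → MonoidAlgebra ℂ Γ := fun x => x.coeff.sum fun γ c => star c • y γ
  have hadjπ : ∀ x, Λπ (adj x) = (Λπ x)ᴴ := fun x => lift_adj' π y hyπ x
  have hadjσ : ∀ x, Λσ (adj x) = (Λσ x)ᴴ := fun x => lift_adj' σ y hyσ x
  have htrΛ : ∀ x, (Λπ x).trace = (Λσ x).trace := trace_lift_eq π σ htr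
  have hker : ∀ x, Λπ x = 0 ↔ Λσ x = 0 := by
    intro x
    rw [← Matrix.trace_conjTranspose_mul_self_eq_zero_iff (A := Λπ x),
      ← Matrix.trace_conjTranspose_mul_self_eq_zero_iff (A := Λσ x), ← hadjπ, ← hadjσ, ← map_mul, ← map_mul, htrΛ]
  let A : Subalgebra ℂ (Matrix n n ℂ) := Λπ.range
  have hA : ∀ a ∈ A, aᴴ ∈ A := by
    rintro a ⟨x, rfl⟩
    exact ⟨_, hadjπ x⟩
  have hf : Function.Surjective Λπ.rangeRestrict := AlgHom.rangeRestrict_surjective Λπ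
  have hcoe : ∀ x, ((Λπ.rangeRestrict x : A) : Matrix n n ℂ) = Λπ x := fun x => rfl
  have hkerR : ∀ a, a ∈ RingHom.ker Λπ.rangeRestrict → Λσ a = 0 := by
    intro a ha
    rw [RingHom.mem_ker] at ha
    have h0 : Λπ a = 0 := by rw [← hcoe, ha]; rfl
    exact (hker a).mp h0
  let Φ : A →ₐ[ℂ] Matrix n n ℂ :=
    (Ideal.Quotient.liftₐ (RingHom.ker Λπ.rangeRestrict) Λσ hkerR).comp
      (Ideal.quotientKerAlgEquivOfSurjective hf).symm.toAlgHom
  have hΦ : ∀ x, Φ (Λπ.rangeRestrict x) = Λσ x := by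
    intro x
    change Ideal.Quotient.liftₐ _ Λσ hkerR
      ((Ideal.quotientKerAlgEquivOfSurjective hf).symm (Λπ.rangeRestrict x)) = _
    rw [Ideal.quotientKerAlgEquivOfSurjective_symm_apply, Ideal.Quotient.liftₐ_apply, Ideal.Quotient.lift_mk]
    rfl
  have hstar : ∀ a : A, Φ ⟨(a : Matrix n n ℂ)ᴴ, hA _ a.2⟩ = (Φ a)ᴴ := by
    intro a
    obtain ⟨x, rfl⟩ := hf a
    have h1 : (⟨((Λπ.rangeRestrict x : A) : Matrix n n ℂ)ᴴ, hA _ (Λπ.rangeRestrict x).2⟩ : A)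
        = Λπ.rangeRestrict (adj x) :=
      Subtype.ext (by change (Λπ x)ᴴ = Λπ _; rw [hadjπ])
    rw [h1, hΦ, hΦ, hadjσ]
  have htrace : ∀ a : A, (Φ a).trace = (a : Matrix n n ℂ).trace := by
    intro a
    obtain ⟨x, rfl⟩ := hf a
    rw [hΦ, hcoe, htrΛ]
  obtain ⟨u, hu, hconj⟩ := exists_unitary_conj_eq_of_trace_eq A hA Φ hstar htrace
  refine ⟨u, hu, fun γ => ?_⟩
  have h1 : σ γ = Λσ (MonoidAlgebra.single γ 1) := by rw [hΛσ, MonoidAlgebra.lift_single, one_smul]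
  have h2 : ((Λπ.rangeRestrict (MonoidAlgebra.single γ 1) : A) : Matrix n n ℂ) = π γ := by
    rw [hcoe, hΛπ, MonoidAlgebra.lift_single, one_smul]
  rw [h1, ← hΦ, hconj, h2]

end Adjoint

section PositiveWords

/-- **Unitary-valued representations of a monoid whose values have equal characteristic polynomials are unitarily
equivalent** — in particular (Γ a free monoid) unitary tuples all of whose POSITIVE words have equal characteristic
polynomials are simultaneously unitarily conjugate.  The adjoint `π(γ)ᴴ = π(γ)⁻¹` is `q_γ(π(γ))` for the common
inverse polynomial `q_γ` of `π(γ)` and `σ(γ)` (`exists_aeval_eq_inv_of_charpoly_eq`), so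
`exists_unitary_conj_of_trace_eq_of_adjoint_mem` applies with `y_γ = q_γ(γ) ∈ ℂ[Γ]`. [cite: Sengupta1994, Thm 2 and proof pp.900–901] -/
theorem exists_unitary_conj_of_charpoly_eq {Γ : Type*} [Monoid Γ] (π σ : Γ →* Matrix n n ℂ)
    (hπ : ∀ γ, π γ ∈ Matrix.unitaryGroup n ℂ) (hσ : ∀ γ, σ γ ∈ Matrix.unitaryGroup n ℂ)
    (h : ∀ γ, (π γ).charpoly = (σ γ).charpoly) :
    ∃ u : Matrix n n ℂ, u ∈ Matrix.unitaryGroup n ℂ ∧ ∀ γ, σ γ = u * π γ * uᴴ := by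
  refine exists_unitary_conj_of_trace_eq_of_adjoint_mem π σ (fun γ => ?_) (fun γ => ?_)
  · have hunit : IsUnit (π γ).det :=
      Matrix.isUnit_det_of_left_inverse (Matrix.mem_unitaryGroup_iff'.mp (hπ γ))
    obtain ⟨q, hqπ, hqσ⟩ := exists_aeval_eq_inv_of_charpoly_eq hunit (h γ)
    have hinvπ : (π γ)⁻¹ = (π γ)ᴴ := Matrix.inv_eq_left_inv (by
      rw [← Matrix.star_eq_conjTranspose]; exact Matrix.mem_unitaryGroup_iff'.mp (hπ γ))
    have hinvσ : (σ γ)⁻¹ = (σ γ)ᴴ := Matrix.inv_eq_left_inv (by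
      rw [← Matrix.star_eq_conjTranspose]; exact Matrix.mem_unitaryGroup_iff'.mp (hσ γ))
    refine ⟨Polynomial.aeval (MonoidAlgebra.of ℂ Γ γ) q, ?_, ?_⟩
    · rw [← Polynomial.aeval_algHom_apply, MonoidAlgebra.lift_of, hqπ, hinvπ]
    · rw [← Polynomial.aeval_algHom_apply, MonoidAlgebra.lift_of, hqσ, hinvσ]
  · rw [Matrix.trace_eq_neg_charpoly_nextCoeff, Matrix.trace_eq_neg_charpoly_nextCoeff, h]

end PositiveWords

section Groups

/-- Conjugation by a unitary matrix preserves the characteristic polynomial. [folklore] -/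
private theorem charpoly_unitary_conj {y : Matrix n n ℂ} (hy : y ∈ Matrix.unitaryGroup n ℂ) (M : Matrix n n ℂ) :
    (y * M * star y).charpoly = M.charpoly := by
  let U : (Matrix n n ℂ)ˣ := ⟨y, star y, hy.2, hy.1⟩
  have hinv : U.val⁻¹ = star y := Matrix.inv_eq_left_inv hy.1
  have := Matrix.charpoly_units_conj U M
  rwa [hinv] at this

/-- «The case G = SU(n) is an immediate consequence of the U(n) case. This is obtained by scaling the y … by a
suitable factor to ensure that it lies in SU(n)» ([Sengupta1994] p.901): every conjugation `M ↦ u M uᴴ` by a unitary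
`u` is also conjugation by a SPECIAL unitary `g = c·u`, `c^n = conj(det u)`. [cite: Sengupta1994, proof of Thm 2 p.901] -/
theorem exists_mem_specialUnitaryGroup_conj_eq [Nonempty n] {u : Matrix n n ℂ} (hu : u ∈ Matrix.unitaryGroup n ℂ) :
    ∃ g : Matrix n n ℂ, g ∈ Matrix.specialUnitaryGroup n ℂ ∧ ∀ M : Matrix n n ℂ, g * M * gᴴ = u * M * uᴴ := by
  have hN : 0 < Fintype.card n := Fintype.card_pos
  have hdet : star u.det * u.det = 1 := (Unitary.mem_iff.mp (Matrix.det_of_mem_unitary hu)).1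
  obtain ⟨c, hcN⟩ := IsAlgClosed.exists_pow_nat_eq (star u.det) hN
  have hnorm_det : ‖u.det‖ = 1 := by
    have h2 : ‖u.det‖ * ‖u.det‖ = 1 := by
      have := congrArg norm hdet
      rwa [norm_mul, norm_star, norm_one] at this
    rcases mul_self_eq_one_iff.mp h2 with h3 | h3
    · exact h3
    · linarith [norm_nonneg u.det]
  have hnorm_c : ‖c‖ = 1 := by
    have h1 : ‖c‖ ^ Fintype.card n = 1 := by
      rw [← norm_pow, hcN, Complex.star_def, Complex.norm_conj, hnorm_det]
    exact (pow_eq_one_iff_of_nonneg (norm_nonneg c) hN.ne').mp h1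
  have hcc : star c * c = 1 := by
    rw [Complex.star_def, Complex.conj_mul', hnorm_c]
    simp
  have hcc' : c * star c = 1 := by rw [mul_comm, hcc]
  refine ⟨c • u, Matrix.mem_specialUnitaryGroup_iff.mpr ⟨?_, ?_⟩, fun M => ?_⟩
  · rw [Matrix.mem_unitaryGroup_iff] at hu ⊢
    rw [star_smul, Matrix.smul_mul, Matrix.mul_smul, smul_smul, hcc', one_smul, hu]
  · rw [Matrix.det_smul, hcN, hdet]
  · rw [Matrix.conjTranspose_smul]
    simp only [Matrix.smul_mul, Matrix.mul_smul, smul_smul, hcc, one_smul]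

/-- **[Sengupta1994] Theorem 2, `G = U(n)`, VERBATIM:** «Suppose that {g_a}_{a ∈ I} and {g'_a}_{a ∈ I} are families
of elements of G such that for every a₁, …, a_k ∈ I the product g_{a₁}⋯g_{a_k} is conjugate in G to g'_{a₁}⋯g'_{a_k}.
Then there is an element y ∈ G such that g'_a = y g_a y⁻¹ for every a ∈ I.»  (Index set arbitrary; NON-EMPTY positive
products only, as printed.) [cite: Sengupta1994, Thm 2 p.900] -/
theorem unitaryGroup_exists_conj_of_prod_conj {ι : Type*} (V W : ι → Matrix.unitaryGroup n ℂ)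
    (h : ∀ l : List ι, l ≠ [] →
      ∃ y : Matrix.unitaryGroup n ℂ, (l.map W).prod = y * (l.map V).prod * y⁻¹) :
    ∃ y : Matrix.unitaryGroup n ℂ, ∀ i, W i = y * V i * y⁻¹ := by
  let π : FreeMonoid ι →* Matrix n n ℂ := (Matrix.unitaryGroup n ℂ).subtype.comp (FreeMonoid.lift V)
  let σ : FreeMonoid ι →* Matrix n n ℂ := (Matrix.unitaryGroup n ℂ).subtype.comp (FreeMonoid.lift W)
  have hchar : ∀ γ, (π γ).charpoly = (σ γ).charpoly := by
    intro γ
    by_cases hγ : FreeMonoid.toList γ = []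
    · have h1 : γ = 1 := FreeMonoid.toList.injective hγ
      subst h1
      rw [map_one, map_one]
    obtain ⟨y, hy⟩ := h (FreeMonoid.toList γ) hγ
    have hσγ : σ γ = (y : Matrix n n ℂ) * π γ * star (y : Matrix n n ℂ) := by
      change ((FreeMonoid.lift W γ : Matrix.unitaryGroup n ℂ) : Matrix n n ℂ)
        = y * ((FreeMonoid.lift V γ : Matrix.unitaryGroup n ℂ) : Matrix n n ℂ) * star (y : Matrix n n ℂ)
      rw [FreeMonoid.lift_apply, FreeMonoid.lift_apply, hy]
      simp
    rw [hσγ, charpoly_unitary_conj y.2]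
  obtain ⟨u, hu, hc⟩ := exists_unitary_conj_of_charpoly_eq π σ (fun γ => (FreeMonoid.lift V γ).2)
    (fun γ => (FreeMonoid.lift W γ).2) hchar
  refine ⟨⟨u, hu⟩, fun i => Subtype.ext ?_⟩
  have hi := hc (FreeMonoid.of i)
  simp only [π, σ, MonoidHom.coe_comp, Function.comp_apply, FreeMonoid.lift_eval_of, Submonoid.coe_subtype] at hi
  rw [hi]
  simp [Matrix.star_eq_conjTranspose]

/-- **[Sengupta1994] Theorem 2, `G = SU(n)`, VERBATIM** (same statement with conjugacy in `SU(n)`; from the `U(n)`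
case by rescaling, `exists_mem_specialUnitaryGroup_conj_eq`). [cite: Sengupta1994, Thm 2 pp.900–901] -/
theorem specialUnitaryGroup_exists_conj_of_prod_conj {ι : Type*} (V W : ι → Matrix.specialUnitaryGroup n ℂ)
    (h : ∀ l : List ι, l ≠ [] →
      ∃ y : Matrix.specialUnitaryGroup n ℂ, (l.map W).prod = y * (l.map V).prod * y⁻¹) :
    ∃ y : Matrix.specialUnitaryGroup n ℂ, ∀ i, W i = y * V i * y⁻¹ := by
  rcases isEmpty_or_nonempty n with hn | hn
  · exact ⟨1, fun i => Subtype.ext (Subsingleton.elim _ _)⟩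
  let π : FreeMonoid ι →* Matrix n n ℂ := (Matrix.specialUnitaryGroup n ℂ).subtype.comp (FreeMonoid.lift V)
  let σ : FreeMonoid ι →* Matrix n n ℂ := (Matrix.specialUnitaryGroup n ℂ).subtype.comp (FreeMonoid.lift W)
  have hmemU : ∀ g : Matrix.specialUnitaryGroup n ℂ, (g : Matrix n n ℂ) ∈ Matrix.unitaryGroup n ℂ :=
    fun g => Matrix.specialUnitaryGroup_le_unitaryGroup g.2
  have hchar : ∀ γ, (π γ).charpoly = (σ γ).charpoly := by
    intro γ
    by_cases hγ : FreeMonoid.toList γ = []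
    · have h1 : γ = 1 := FreeMonoid.toList.injective hγ
      subst h1
      rw [map_one, map_one]
    obtain ⟨y, hy⟩ := h (FreeMonoid.toList γ) hγ
    have hσγ : σ γ = (y : Matrix n n ℂ) * π γ * star (y : Matrix n n ℂ) := by
      change ((FreeMonoid.lift W γ : Matrix.specialUnitaryGroup n ℂ) : Matrix n n ℂ)
        = y * ((FreeMonoid.lift V γ : Matrix.specialUnitaryGroup n ℂ) : Matrix n n ℂ) * star (y : Matrix n n ℂ)
      rw [FreeMonoid.lift_apply, FreeMonoid.lift_apply, hy, ← Matrix.star_eq_inv]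
      simp [Matrix.specialUnitaryGroup.coe_star]
    rw [hσγ, charpoly_unitary_conj (hmemU y)]
  obtain ⟨u, hu, hc⟩ := exists_unitary_conj_of_charpoly_eq π σ (fun γ => hmemU (FreeMonoid.lift V γ))
    (fun γ => hmemU (FreeMonoid.lift W γ)) hchar
  obtain ⟨g, hg, hgc⟩ := exists_mem_specialUnitaryGroup_conj_eq hu
  refine ⟨⟨g, hg⟩, fun i => Subtype.ext ?_⟩
  have hi := hc (FreeMonoid.of i)
  simp only [π, σ, MonoidHom.coe_comp, Function.comp_apply, FreeMonoid.lift_eval_of, Submonoid.coe_subtype] at hi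
  change (W i : Matrix n n ℂ) = g * (V i : Matrix n n ℂ) *
    ((⟨g, hg⟩ : Matrix.specialUnitaryGroup n ℂ)⁻¹ : Matrix.specialUnitaryGroup n ℂ)
  rw [← Matrix.star_eq_inv, Matrix.specialUnitaryGroup.coe_star]
  change (W i : Matrix n n ℂ) = g * (V i : Matrix n n ℂ) * star g
  rw [hi, Matrix.star_eq_conjTranspose, hgc]

end Groups

end Literature.LinearAlgebra.Matrix
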